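import Summits.CriticalPhenomena.PercolationContinuityZ3.Theorems.PercNearOneGluingNoHeavyLowerTailSahiCombOrderTwoC3
import Summits.CriticalPhenomena.PercolationContinuityZ3.Theorems.SahiMasterFamilyExplicitMinorDomination

/-!
# The TOP half of comb ORDER-1(3) implies EXPLICIT MINOR DOMINATION `MD_3`, hence the POINTWISE master conjecture at order 3

Unit `prim-master-conj` (crux anchor stmt-CriticalPhenomena-4575, helper work), gen 19; memo
`run/shared/lean/prim/prim-l12/prim-master-conj/POINTWISE.md` §20; INEQ-CLAIMS rows COMB-M-E3 / S2-GRAPH.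

bnk-2 (gen 7, `…SahiCombOrderTwoC3`) proved: if `c_3 ≤ c_2` on every coefficient line of the three-copy comb (tensor-Bernstein) array of every
triple of increasing events on every finite cube with a second point (the census-clean top half of INEQ-CLAIMS row COMB-M-E3, `m ≤ 5` exhaustive),
then Sahi's `C_3` holds for product measures (`MasterFamilyNonneg 3`, Kahn's Conjecture 5).  Their key step `SahiCombTopC3.logDeriv_form_nonneg`
gives, for the fibre cubic `Q(x) = E_3(μ_{p[e↦x]}; 1_U) = Σ c_i x^i` along any coordinate `e`, `0 ≤ 2c_0 + c_1σ − c_3σ³` for every `σ ∈ [0,1]`.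

THIS FILE adds the POINTWISE consequence.  At `σ = 1` that inequality is the `t → 1` endpoint inequality `2Q(1) − Q′(1) ≥ 0` of gen 18's
explicit minor domination `MD_3`; the `t → 0` endpoint inequality `2Q(0) + Q′(0) = 2c_0 + c_1 ≥ 0` is NOT independent:
`(2c_0 + c_1) − (2c_0 + c_1 − c_3) = c_3 = ν_0ν_1ν_2 ≥ 0` (the leading coefficient of the fibre cubic of an increasing triple is the product of the
three section increments `ν_j = μ(U_j^{e←1}) − μ(U_j^{e←0})`, `coeff_three_fibre_eq_prod`; master-conj's `coeff_sahiEP_top`), and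
`Q(t) − (1−t)²Q(0) − t²Q(1) = t(1−t)·[(2c_0 + c_1 − c_3) + (1−t)c_3]`.  Hence:
* `sahiE_three_ge_sq_minors_of_combTop` — the top half of ORDER-1(3) ⟹ `MD_3`: `(1−p_e)²·E_3(U^{e←0}) + p_e²·E_3(U^{e←1}) ≤ E_3(U)` for every
  increasing triple on every finite cube, every coordinate, every parameter (on `Fin r` by the substitution and P2's `sahiE_three_decomp_coord`, on a general finite cube by transport,
  `comapFam_secAt`);
* **`masterFamilyEqIff_three_of_combLine_top_le`** — ⟹ `MasterFamilyEqIff 3`, the pointwise master conjecture at order 3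
  (`E_3(μ_p; 1_U) = 0 ↔ U ∈ Z_3` at every interior `p`), via gen 18's `masterFamilyEqIff_of_explicitDomination`;
  `masterFamilyEqIff_three_of_combOrderTwoTop` — the same from the two-dimensional law `CombOrderTwoTop 3` (ORDER-2-TOP(3)).
So the census-clean comb rows COMB-M-E3 (top half) / S2 imply not only Kahn's Conjecture 5 but also the zero-locus half of the master conjecture.
HONEST FRAMING: conditional bridges; COMB-M-E3, `CombOrderTwoTop 3`, `C_3`, `MasterFamilyEqIff 3` remain OPEN. [this work]
-/

noncomputable section

open scoped Classical

namespace Summit.CriticalPhenomena.PercolationContinuityZ3.Theorems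

open Finset Function Polynomial
open Literature.Combinatorics.Sahi2008
open Literature.Probability.Percolation.DecisionTree (ind)
open SahiComb SahiCombTopC3

namespace Pointwise

/-! ### 1. The leading coefficient of the fibre cubic is `ν_0ν_1ν_2` -/

section Fibre

variable {ι : Type} [Fintype ι]

/-- **`[x³] E_3(μ_{p[e↦x]}; 1_U) = Π_j (μ_p(U_j^{e←1}) − μ_p(U_j^{e←0}))`** — only the all-singleton partition reaches the top degree
(`coeff_sahiEP_top`). [this work] -/
theorem coeff_three_fibre_eq_prod (p : ι → unitInterval) (e : ι) (U : Fin 3 → Set (Set ι)) :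
    (sahiEP (secPoly p e) 3 (fun j => ind (U j))).coeff 3
      = ∏ j, (ex (bernoulliWeight p) (ind (secAt e true (U j))) - ex (bernoulliWeight p) (ind (secAt e false (U j)))) := by
  rw [coeff_sahiEP_top (secPoly p e) (natDegree_secPoly_le p e) 2 (fun j => ind (U j))]
  simp only [even_two, Even.neg_pow, one_pow, one_mul, coeff_secPoly_one, secEx_ind_eq]

/-- For an increasing triple the leading coefficient of the fibre cubic is `≥ 0`. [this work] -/
theorem coeff_three_fibre_nonneg (p : ι → unitInterval) (e : ι) (U : Fin 3 → Set (Set ι)) (hU : ∀ j, IsUpperSet (U j)) :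
    0 ≤ (sahiEP (secPoly p e) 3 (fun j => ind (U j))).coeff 3 := by
  rw [coeff_three_fibre_eq_prod]
  exact prod_nonneg fun j _ => ex_secAt_true_sub_false_nonneg p e (hU j)

end Fibre

/-! ### 2. `MD_3` on the cube `Fin r` from the top half of ORDER-1(3) -/

section FinCube

variable {r : ℕ}

/-- **The top half of ORDER-1(3) ⟹ `MD_3` on `Fin r`**: `(1−p_e)²E_3(U^{e←0}) + p_e²E_3(U^{e←1}) ≤ E_3(U)` for every increasing triple,
every coordinate `e` and every `p` (from `logDeriv_form_nonneg` at `σ = 1` and `c_3 ≥ 0`). [this work] -/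
theorem sahiE_three_ge_sq_minors_of_combTop_fin
    (hTop : ∀ (κ : Type) [Fintype κ] (V : Fin 3 → Set (Set κ)), (∀ i, IsUpperSet (V i)) →
      ∀ (a b : κ), a ≠ b → ∀ k : κ → ℕ, combLine 3 V a k 3 ≤ combLine 3 V a k 2)
    (p : Fin r → unitInterval) (e : Fin r) (U : Fin 3 → Set (Set (Fin r))) (hU : ∀ i, IsUpperSet (U i)) :
    (1 - (p e : ℝ)) ^ 2 * sahiE (bernoulliWeight p) 3 (fun j => ind (secAt e false (U j)))
      + (p e : ℝ) ^ 2 * sahiE (bernoulliWeight p) 3 (fun j => ind (secAt e true (U j)))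
      ≤ sahiE (bernoulliWeight p) 3 (fun j => ind (U j)) := by
  set Q := sahiEP (secPoly p e) 3 (fun j => ind (U j)) with hQ
  have h1 := logDeriv_form_nonneg hTop p e U hU 1
  simp only [Set.Icc.coe_one, mul_one, one_pow] at h1
  have hc3 : 0 ≤ Q.coeff 3 := coeff_three_fibre_nonneg p e U hU
  have hdeg : Q.natDegree ≤ 3 := natDegree_sahiEP_le (secPoly p e) (natDegree_secPoly_le p e) 3 _
  have hrep := cubic_eval_eq hdeg
  -- the three values of the fibre cubic
  have hE0 : sahiE (bernoulliWeight p) 3 (fun j => ind (secAt e false (U j))) = Q.eval 0 := by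
    have h := SahiCoordinateBernstein.eval_fibre_boolParam p e false U
    have hb : ((boolParam false : unitInterval) : ℝ) = 0 := by simp [boolParam]
    rw [hb] at h
    exact h.symm
  have hE1 : sahiE (bernoulliWeight p) 3 (fun j => ind (secAt e true (U j))) = Q.eval 1 := by
    have h := SahiCoordinateBernstein.eval_fibre_boolParam p e true U
    have hb : ((boolParam true : unitInterval) : ℝ) = 1 := by simp [boolParam]
    rw [hb] at h
    exact h.symm
  -- E_3(U) through the two sections and the two one-coordinate Bernstein pieces (no `update` needed)
  have hdec := SahiCoordinateBernstein.sahiE_three_decomp_coord p e U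
  have hp1 : SahiCoordinateBernstein.coordPiece₁ p e U = -(Q.coeff 2 + Q.coeff 3) := rfl
  have hp2 : SahiCoordinateBernstein.coordPiece₂ p e U = -(Q.coeff 2 + 2 * Q.coeff 3) := rfl
  rw [hp1, hp2] at hdec
  rw [hdec, hE0, hE1, hrep 0, hrep 1]
  have ht0 : 0 ≤ (p e : ℝ) := (p e).2.1
  have ht1 : 0 ≤ 1 - (p e : ℝ) := sub_nonneg.2 (p e).2.2
  nlinarith [mul_nonneg (mul_nonneg ht0 ht1) h1, mul_nonneg (mul_nonneg (mul_nonneg ht0 ht1) ht1) hc3]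

end FinCube

/-! ### 3. Transport to an arbitrary finite cube -/

section Transport

variable {ι κ : Type} [Fintype ι] [Fintype κ]

omit [Fintype ι] [Fintype κ] in
/-- Pull-back along a bijection commutes with sectioning: `comapFam e⁻¹ (U^{x←b}) = (comapFam e⁻¹ U)^{e x ← b}`. [this work] -/
theorem comapFam_secAt (e : ι ≃ κ) (x : ι) (b : Bool) (U : Set (Set ι)) :
    ThreePartition.comapFam e.symm (secAt x b U) = secAt (e x) b (ThreePartition.comapFam e.symm U) := by
  ext T
  simp only [ThreePartition.comapFam, Set.mem_setOf_eq, mem_secAt]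
  have himg : e.symm '' (forceAt (e x) b T) = forceAt x b (e.symm '' T) := by
    cases b
    · simp only [forceAt, cond_false]
      rw [Set.image_sdiff e.symm.injective, Set.image_singleton, Equiv.symm_apply_apply]
    · simp only [forceAt, cond_true]
      rw [Set.image_insert_eq, Equiv.symm_apply_apply]
  rw [himg]

/-- **The top half of ORDER-1(3) ⟹ `MD_3` on every finite cube.** [this work] -/
theorem sahiE_three_ge_sq_minors_of_combTop
    (hTop : ∀ (κ : Type) [Fintype κ] (V : Fin 3 → Set (Set κ)), (∀ i, IsUpperSet (V i)) →
      ∀ (a b : κ), a ≠ b → ∀ k : κ → ℕ, combLine 3 V a k 3 ≤ combLine 3 V a k 2)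
    (p : ι → unitInterval) (x : ι) (U : Fin 3 → Set (Set ι)) (hU : ∀ i, IsUpperSet (U i)) :
    (1 - (p x : ℝ)) ^ 2 * sahiE (bernoulliWeight p) 3 (fun j => ind (secAt x false (U j)))
      + (p x : ℝ) ^ 2 * sahiE (bernoulliWeight p) 3 (fun j => ind (secAt x true (U j)))
      ≤ sahiE (bernoulliWeight p) 3 (fun j => ind (U j)) := by
  obtain ⟨φ⟩ : Nonempty (ι ≃ Fin (Fintype.card ι)) := ⟨Fintype.equivFin ι⟩
  have hU' : ∀ j, IsUpperSet (ThreePartition.comapFam φ.symm (U j)) :=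
    fun j => SahiC4CombBridge.isUpperSet_comapFam φ (hU j)
  have h := sahiE_three_ge_sq_minors_of_combTop_fin hTop (p ∘ φ.symm) (φ x) (fun j => ThreePartition.comapFam φ.symm (U j)) hU'
  have hpx : ((p ∘ φ.symm) (φ x) : ℝ) = (p x : ℝ) := by simp
  rw [hpx] at h
  have hsec : ∀ b, (fun j => ind (secAt (φ x) b (ThreePartition.comapFam φ.symm (U j))))
      = fun j => ind (ThreePartition.comapFam φ.symm (secAt x b (U j))) := by
    intro b; funext j; rw [comapFam_secAt]
  rw [hsec false, hsec true, SahiC4CombBridge.sahiE_bernoulliWeight_comap_equiv φ p 3 (fun j => secAt x false (U j)),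
    SahiC4CombBridge.sahiE_bernoulliWeight_comap_equiv φ p 3 (fun j => secAt x true (U j)),
    SahiC4CombBridge.sahiE_bernoulliWeight_comap_equiv φ p 3 U] at h
  exact h

end Transport

/-! ### 4. The pointwise master conjecture at order 3 from the comb rows -/

/-- **THE TOP HALF OF ORDER-1(3) IMPLIES THE POINTWISE MASTER CONJECTURE AT ORDER 3**: if `c_3 ≤ c_2` on every coefficient line of
the three-copy comb array of every triple of increasing events on every finite cube with a second point, then `MasterFamilyEqIff 3`
(`E_3(μ_p; 1_U) = 0 ↔ U ∈ Z_3` for every interior `p`; it contains Kahn's Conjecture 5 in strict form). [this work] -/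
theorem masterFamilyEqIff_three_of_combLine_top_le
    (hTop : ∀ (κ : Type) [Fintype κ] (V : Fin 3 → Set (Set κ)), (∀ i, IsUpperSet (V i)) →
      ∀ (a b : κ), a ≠ b → ∀ k : κ → ℕ, combLine 3 V a k 3 ≤ combLine 3 V a k 2) :
    MasterFamilyEqIff 3 :=
  masterFamilyEqIff_of_explicitDomination (by norm_num) fun κ _ p _ U hU e => by
    simpa using sahiE_three_ge_sq_minors_of_combTop hTop p e U hU

/-- **ORDER-2-TOP(3) ⟹ the pointwise master conjecture at order 3** (the census-clean two-dimensional comb law `CombOrderTwoTop 3`,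
through bnk-2's `combLine_three_top_le_of_orderTwoTop`). [this work] -/
theorem masterFamilyEqIff_three_of_combOrderTwoTop (h : CombOrderTwoTop 3) : MasterFamilyEqIff 3 :=
  masterFamilyEqIff_three_of_combLine_top_le fun _ _ V hV a b hab k =>
    combLine_three_top_le_of_orderTwoTop h V hV a b hab k

end Pointwise

end Summit.CriticalPhenomena.PercolationContinuityZ3.Theorems

end
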